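/-
Copyright (c) 2026 the pub-hodgecm-mathlib formalisation cell (harness21).  Prover seat hodgecm-mathlib-K2Liu-p01 (g0): Track B «K2-LIT», #184♮ = hLiu418,
helper H7 for socket #13 `sig_K2LiuDoublingUnfold` (U5 «DOUBLING ZETA», LEAD F0P6-plan (g10) DEAL BY NAME K2/STATUS 2026-09-03T21:14:18Z, RULING 21:19:59Z).
-/
import Literature.NumberTheory.K2Lit.DoublingZetaIntegral
import Literature.NumberTheory.GelbartRogawski1991.CompatibleSplittingCMDoubling
import Summits.HodgeConjecture.HodgeConjecture.Theorems.K2LiuSiegelEisensteinDoubledLeftInvariant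
import Summits.HodgeConjecture.HodgeConjecture.Theorems.K2LiuDoublingUnfoldOrbitPrelims
import Summits.HodgeConjecture.HodgeConjecture.Theorems.K2LiuDoublingUnfoldBridge
import HarnessLib

/-!
# Crux `HLiu418`, Track B road `K2_Liu`, unit U5, helper H7 for socket #13 `sig_K2LiuDoublingUnfold`:
# the ORBIT BIJECTION `G(L⁺) ≃ P_Δ(L⁺)\H(L⁺)`, `γ ↦ P_Δ(L⁺)·ι(ιA γ, 1)`, and the Eisenstein series read along `ι(G × G)`

Cell `hodgecm-mathlib`, crux item hLiu418 = `stmt-HodgeConjecture-24832`, route of record `HCCMUnconditional`; squad K2 ∕ K2Liu, LEAD F0P6-plan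
(g10), prover K2Liu-p01 (g0) (REPORT-FIRST plan for #13, item H7).  THEOREMS ONLY (no `def`, no instance, no notation, no named-fact hypothesis,
no `sorry`, default heartbeats); imports ★ K2Lit `DoublingZetaIntegral`, ★ `CompatibleSplittingCMDoubling` (`inlGRat`, `inlG_rationalPairToAdelic`),
★ #10b `K2LiuSiegelEisensteinDoubledLeftInvariant` (p854756: `apply_siegelDeltaRat_mul`), ★ H1∕H2 `K2LiuDoublingUnfoldOrbitPrelims` (p854919), ★ H5
`K2LiuDoublingUnfoldBridge` (p854938) + HarnessLib; lane `--supports stmt-HodgeConjecture-24832 --as helper` (count-neutral).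

FRAME: the #13 binders (`e : Fin N × Fin 1 ≃ Fin n`, `H`, `dV`, `dW`, `t ≠ 0`, `g`, `hg`, `ιA`, `hιA`); `G := (adelicGroupData L⁺ L c N H).Adelic`,
`Γ := 𝒢.quotientSubgroup = G(L⁺)`, `r γ := ι(ιA γ, 1) = iotaLeft (ιA γ)`.  The SINGLE-ORBIT INPUT (Liu 2021 (B.5) at `a = 0`, anisotropic `V`) is
carried as the hypothesis `hMain : ∀ h ∈ H(L⁺), ∃ a₀ ∈ U(diag dV)(L⁺), h · ι(a₀, 1)⁻¹ ∈ P_Δ` — item H4 of the plan (its own file; here a premise).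
WHAT IS PROVED.
* §1 `iotaGG_inl_one` (`ι(x, 1) = inlG x`), `iotaLeft_toAdelic_mem_ratH` ∕ `iotaLeft_iotaA_mem_ratH` — **`r γ ∈ H(L⁺)` for `γ ∈ G(L⁺)`**
  (★ `adelicInl_toAdelic`, ★ `inlG_rationalPairToAdelic`, H5 `iotaA_mem_quotientSubgroup_iff`).
* §2 `exists_orbitEquiv` — **under `hMain`, `σ : Γ ≃ P_Δ(L⁺)\H(L⁺)`, `σ γ = ⟦r γ⟧`**: injective by H1 `isSiegelDelta_iotaLeft_iff` + H5 `iotaA_bijective`,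
  surjective by `hMain` + H5 (every rational `a₀` is `ιA γ`).
* §3 `iotaLeft_mul_iotaV` (`ι(a,1)·ι(Y₁,Y₂) = ι(Y₂,Y₂)·ι(Y₂⁻¹ a Y₁, 1)`), `apply_iotaLeft_mul_iotaV` — **the summand factorises**:
  `f(r γ · ι(ιA k₁⁻¹, ιA k₂⁻¹)) = χ_s(ι(ιA k₂⁻¹, ιA k₂⁻¹)) · c(k₂ γ k₁⁻¹)`, `c k := f(r k)` (section law on `ι(Y₂,Y₂) ∈ P_Δ(𝔸)`).
* §4 `eisensteinSeriesDelta_eq_tsum` ∕ `summable_eisenstein_iff` — **under `hMain`**, for any `F : H(𝔸) → ℂ` blind to LEFT rational Siegel factors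
  (`F(p x) = F x`, `p ∈ P_Δ(L⁺)`; e.g. a Siegel section, ★ `apply_siegelDeltaRat_mul`, or its norm): `E_F(h′) = Σ'_{γ ∈ Γ} F(r γ · h′)` and
  `Summable_q |F(q.out · h′)| ⟺ Summable_γ |F(r γ · h′)|` (Mathlib `Equiv.tsum_eq` ∕ `Equiv.summable_iff` along `σ`; ★ H2 for representatives).
Together (assembly file): `E_f(ι(ιA g₁⁻¹, ιA g₂⁻¹)) = χ_s(ι(ιA g₂⁻¹, ιA g₂⁻¹)) · Σ_γ c(g₂ γ g₁⁻¹)` — the orbit-sum kernel of the ★ H3 engine times the H6 twist.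

HONEST LABEL.  Count-neutral helper; `HC_CM` is proved only modulo the 7 printed citations (hLiu418 = 24832, h413 = 24833) until rung 0 closes.

## References
* [Liu2021] Y. Liu, *Fourier–Jacobi cycles and arithmetic relative trace formula*, Camb. J. Math. 9 (2021): App. B §B.3 (B.5) p. 101, Lem. B.11 p. 102.
* [GelbartPiatetskishapiroRallis1987] S. Gelbart, I. Piatetski-Shapiro, S. Rallis, LNM 1254 (1987), Part A §1–§2 (main orbit, stabiliser, basic identity).
-/

noncomputable section

open scoped Matrix
open NumberField IsDedekindDomain

namespace Summit.HodgeConjecture.HodgeConjecture.Cruxes.HLiu418.K2LiuDoublingUnfoldOrbit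

open Literature.NumberTheory.Automorphic Literature.NumberTheory.GaloisRepresentations
open Literature.NumberTheory.Automorphic.UnitaryGroup (adelicGroupData adelicVal)
open Literature.NumberTheory.GelbartRogawski1991 Literature.NumberTheory.GelbartRogawski1991.GRConstruction
open Literature.NumberTheory.K2Lit.SiegelDoubled
open Summit.HodgeConjecture.HodgeConjecture.Cruxes.HLiu418.K2LiuDoublingUnfoldOrbitPrelims
open Summit.HodgeConjecture.HodgeConjecture.Cruxes.HLiu418.K2LiuDoublingUnfoldBridge
open Summit.HodgeConjecture.HodgeConjecture.Cruxes.HLiu418.K2LiuSiegelEisensteinDoubledLeftInvariant (apply_siegelDeltaRat_mul)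

variable (L : Type) [Field L] [NumberField L] [IsCMField L]
variable {N n : ℕ} (e : Fin N × Fin 1 ≃ Fin n) (H : Matrix (Fin N) (Fin N) L)
  (dV : Fin N → L) (hdV : ∀ i, IsCMField.complexConj L (dV i) = dV i)
  (dW : Fin 1 → L) (hdW : ∀ i, IsCMField.complexConj L (dW i) = dW i)
  (t : L) (ht : t ≠ 0) (g : GL (Fin N) L)
  (hg : formCongr ((IsCMField.complexConj L : L ≃ₐ[↥(maximalRealSubfield L)] L) : L →+* L) g (t • H) = Matrix.diagonal dV)
  (ιA : (adelicGroupData (↥(maximalRealSubfield L)) L (IsCMField.complexConj L) N H).Adelic →*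
    ↥(UnitaryGroup.adelic (↥(maximalRealSubfield L)) L (IsCMField.complexConj L) N (Matrix.diagonal dV)))
  (hιA : ∀ k, ((ιA k : ↥(UnitaryGroup.adelic (↥(maximalRealSubfield L)) L (IsCMField.complexConj L) N (Matrix.diagonal dV))) :
        GL (Fin N) (AdeleRing (𝓞 L) L)) =
      (toAdeleGL L g)⁻¹ * adelicVal (↥(maximalRealSubfield L)) L (IsCMField.complexConj L) N H k * toAdeleGL L g)

/-! ## §1 `ι(ιA γ, 1) ∈ H(L⁺)` for `γ ∈ G(L⁺)` -/

/-- `ι(x, 1) = inlG x` (`x ⊕ 1`; both have the matrix `reindex e₂ (diag (xₑ, 1))`). [cite: Liu2021, §B.3 p. 101] -/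
theorem iotaGG_inl_one (x : UnitaryGroup.adelicPair (Fp L) L (IsCMField.complexConj L) N 1 (Matrix.diagonal dV) (Matrix.diagonal dW)) :
    iotaGG L e dV hdV dW hdW (x, 1) = inlG L e dV hdV dW hdW x := by
  apply Subtype.ext
  rw [coe_iotaGG, coe_inlG]
  simp only [OneMemClass.coe_one, map_one]

/-- **`ι(a₀, 1) ∈ H(L⁺)` for rational `a₀ ∈ U(diag dV)(L⁺)`**: `ι(a₀,1) = inlG(a₀ ⊗ 1) = (inlGRat (a₀ ⊗ 1))_𝔸` (★ `adelicInl_toAdelic`, `iotaGG_inl_one`, ★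
`inlG_rationalPairToAdelic`). [cite: Liu2021, §B.3 p. 101] -/
theorem iotaLeft_toAdelic_mem_ratH (a₀ : UnitaryGroup.rational (Fp L) L (IsCMField.complexConj L) N (Matrix.diagonal dV)) :
    iotaLeft L e dV hdV dW hdW (UnitaryGroup.toAdelic (Fp L) L (IsCMField.complexConj L) N (Matrix.diagonal dV) a₀) ∈ ratH L e dV hdV dW hdW := by
  rw [iotaLeft_apply, iotaV, MonoidHom.comp_apply, MonoidHom.prodMap_def, MonoidHom.prod_apply, MonoidHom.comp_apply, MonoidHom.comp_apply,
    MonoidHom.coe_fst, MonoidHom.coe_snd, map_one, UnitaryGroup.adelicInl_toAdelic, iotaGG_inl_one, inlG_rationalPairToAdelic]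
  exact ⟨_, rfl⟩

include ht hg hιA in
/-- **`ι(ιA γ, 1) ∈ H(L⁺)` for `γ ∈ G(L⁺)`** (`ιA γ` is rational, H5 `iotaA_mem_quotientSubgroup_iff`; then `iotaLeft_toAdelic_mem_ratH`).
[cite: Liu2021, Lem. B.11 p. 102] -/
theorem iotaLeft_iotaA_mem_ratH {γ : (adelicGroupData (↥(maximalRealSubfield L)) L (IsCMField.complexConj L) N H).Adelic}
    (hγ : γ ∈ (adelicGroupData (↥(maximalRealSubfield L)) L (IsCMField.complexConj L) N H).quotientSubgroup) :
    iotaLeft L e dV hdV dW hdW (ιA γ) ∈ ratH L e dV hdV dW hdW := by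
  have hrat := (iotaA_mem_quotientSubgroup_iff L H dV t ht g hg ιA hιA γ).2 hγ
  rw [AdelicGroupData.quotientSubgroup, show (adelicGroupData (↥(maximalRealSubfield L)) L (IsCMField.complexConj L) N
      (Matrix.diagonal dV)).center' = ⊥ from rfl, bot_sup_eq, AdelicGroupData.arithmeticSubgroup] at hrat
  obtain ⟨a₀, ha₀⟩ := MonoidHom.mem_range.mp hrat
  have h : ιA γ = UnitaryGroup.toAdelic (Fp L) L (IsCMField.complexConj L) N (Matrix.diagonal dV) a₀ := ha₀.symm
  rw [h]
  exact iotaLeft_toAdelic_mem_ratH L e dV hdV dW hdW a₀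

/-! ## §2 The orbit bijection `Γ ≃ P_Δ(L⁺)\H(L⁺)` -/

include ht hg hιA in
/-- **THE ORBIT BIJECTION** (Liu 2021 (B.5) at `a = 0`: ONE `G × G`-orbit with stabiliser the diagonal): under the single-orbit input `hMain`
(every `h ∈ H(L⁺)` is `p · ι(a₀, 1)` with `p ∈ P_Δ`, `a₀ ∈ U(diag dV)(L⁺)`), the map `γ ↦ P_Δ(L⁺) · ι(ιA γ, 1)` is a bijection
`G(L⁺) ≃ P_Δ(L⁺)\H(L⁺)`: injective since `ι(ιA(γγ′⁻¹), 1) ∈ P_Δ ⟹ ιA(γγ′⁻¹) = 1` (H1 `isSiegelDelta_iotaLeft_iff`) and `ιA` is injective (H5),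
surjective by `hMain` and `ιA(G(L⁺)) = U(diag dV)(L⁺)` (H5). [cite: Liu2021, §B.3 (B.5) p. 101] [cite: GelbartPiatetskishapiroRallis1987, Part A §1] -/
theorem exists_orbitEquiv
    (hMain : ∀ h : ratH L e dV hdV dW hdW, ∃ a₀ : UnitaryGroup.rational (Fp L) L (IsCMField.complexConj L) N (Matrix.diagonal dV),
      IsSiegelDelta L e dV hdV dW hdW ((h : HA L e dV hdV dW hdW) *
        (iotaLeft L e dV hdV dW hdW (UnitaryGroup.toAdelic (Fp L) L (IsCMField.complexConj L) N (Matrix.diagonal dV) a₀))⁻¹)) :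
    ∃ σ : (adelicGroupData (↥(maximalRealSubfield L)) L (IsCMField.complexConj L) N H).quotientSubgroup ≃ SiegelDeltaQuot L e dV hdV dW hdW,
      ∀ γ : (adelicGroupData (↥(maximalRealSubfield L)) L (IsCMField.complexConj L) N H).quotientSubgroup,
        σ γ = Quotient.mk (MulAction.orbitRel (siegelDeltaRat L e dV hdV dW hdW) (ratH L e dV hdV dW hdW))
          ⟨iotaLeft L e dV hdV dW hdW (ιA γ), iotaLeft_iotaA_mem_ratH L e H dV hdV dW hdW t ht g hg ιA hιA γ.2⟩ := by
  set r : (adelicGroupData (↥(maximalRealSubfield L)) L (IsCMField.complexConj L) N H).quotientSubgroup → ratH L e dV hdV dW hdW :=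
    fun γ => ⟨iotaLeft L e dV hdV dW hdW (ιA γ), iotaLeft_iotaA_mem_ratH L e H dV hdV dW hdW t ht g hg ιA hιA γ.2⟩ with hr_def
  have hr : ∀ γ, ((r γ : ratH L e dV hdV dW hdW) : HA L e dV hdV dW hdW) = iotaLeft L e dV hdV dW hdW (ιA γ) := fun γ => rfl
  refine ⟨Equiv.ofBijective (fun γ => Quotient.mk _ (r γ)) ⟨fun γ γ' hγγ' => ?_, fun q => ?_⟩, fun γ => rfl⟩
  · -- injectivity
    have hrel : MulAction.orbitRel (siegelDeltaRat L e dV hdV dW hdW) (ratH L e dV hdV dW hdW) (r γ) (r γ') := Quotient.exact hγγ'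
    obtain ⟨p, hp⟩ := MulAction.mem_orbit_iff.1 (MulAction.orbitRel_apply.1 hrel)
    rw [Subgroup.smul_def, smul_eq_mul] at hp
    -- `p = r γ · (r γ')⁻¹ = ι(ιA (γ γ'⁻¹), 1)` is in `P_Δ`
    have hpS : IsSiegelDelta L e dV hdV dW hdW ((p : ratH L e dV hdV dW hdW) : HA L e dV hdV dW hdW) :=
      Subgroup.mem_subgroupOf.1 (show (p : ratH L e dV hdV dW hdW) ∈ (siegelDelta L e dV hdV dW hdW).subgroupOf (ratH L e dV hdV dW hdW)
        from p.2)
    have hpeq : ((p : ratH L e dV hdV dW hdW) : HA L e dV hdV dW hdW) =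
        iotaLeft L e dV hdV dW hdW (ιA ((γ : (adelicGroupData (↥(maximalRealSubfield L)) L (IsCMField.complexConj L) N H).Adelic) * ((γ' : (adelicGroupData (↥(maximalRealSubfield L)) L (IsCMField.complexConj L) N H).Adelic))⁻¹)) := by
      have h1 : ((p : ratH L e dV hdV dW hdW) : HA L e dV hdV dW hdW) = (r γ : HA L e dV hdV dW hdW) * ((r γ' : HA L e dV hdV dW hdW))⁻¹ := by
        rw [← hp, Subgroup.coe_mul, mul_inv_cancel_right]
      rw [h1, hr, hr]
      simp only [map_mul, map_inv]
    rw [hpeq, isSiegelDelta_iotaLeft_iff] at hpS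
    have hinj := (iotaA_bijective L H dV t ht g hg ιA hιA).1
    have h2 : (γ : (adelicGroupData (↥(maximalRealSubfield L)) L (IsCMField.complexConj L) N H).Adelic) * ((γ' : (adelicGroupData (↥(maximalRealSubfield L)) L (IsCMField.complexConj L) N H).Adelic))⁻¹ = 1 :=
      hinj (by rw [hpS, map_one])
    exact Subtype.ext (mul_inv_eq_one.1 h2)
  · -- surjectivity
    induction q using Quotient.inductionOn with
    | h h =>
      obtain ⟨a₀, ha₀⟩ := hMain h
      -- `toAdelic a₀ = ιA γ` with `γ ∈ G(L⁺)`
      obtain ⟨γ, hγ⟩ := (iotaA_bijective L H dV t ht g hg ιA hιA).2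
        (UnitaryGroup.toAdelic (Fp L) L (IsCMField.complexConj L) N (Matrix.diagonal dV) a₀)
      have hγmem : γ ∈ (adelicGroupData (↥(maximalRealSubfield L)) L (IsCMField.complexConj L) N H).quotientSubgroup := by
        rw [← iotaA_mem_quotientSubgroup_iff L H dV t ht g hg ιA hιA γ, hγ, AdelicGroupData.quotientSubgroup,
          show (adelicGroupData (↥(maximalRealSubfield L)) L (IsCMField.complexConj L) N (Matrix.diagonal dV)).center' = ⊥ from rfl,
          bot_sup_eq, AdelicGroupData.arithmeticSubgroup]
        exact ⟨a₀, rfl⟩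
      refine ⟨⟨γ, hγmem⟩, ?_⟩
      -- `p := h · (r γ)⁻¹ ∈ P_Δ(L⁺)` and `p · r γ = h`
      show Quotient.mk _ (r ⟨γ, hγmem⟩) = Quotient.mk _ h
      refine (Quotient.sound (MulAction.orbitRel_apply.2 (MulAction.mem_orbit_iff.2 ?_))).symm
      have hS : IsSiegelDelta L e dV hdV dW hdW (((h * (r ⟨γ, hγmem⟩)⁻¹ : ratH L e dV hdV dW hdW)) : HA L e dV hdV dW hdW) := by
        rw [Subgroup.coe_mul, Subgroup.coe_inv, hr]
        show IsSiegelDelta L e dV hdV dW hdW ((h : HA L e dV hdV dW hdW) * (iotaLeft L e dV hdV dW hdW (ιA γ))⁻¹)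
        rw [hγ]
        exact ha₀
      refine ⟨⟨h * (r ⟨γ, hγmem⟩)⁻¹, Subgroup.mem_subgroupOf.2 hS⟩, ?_⟩
      rw [Subgroup.smul_def, smul_eq_mul]
      show h * (r ⟨γ, hγmem⟩)⁻¹ * r ⟨γ, hγmem⟩ = h
      rw [inv_mul_cancel_right]

/-! ## §3 The summand factorises -/

/-- `ι(a, 1) · ι(Y₁, Y₂) = ι(Y₂, Y₂) · ι(Y₂⁻¹ a Y₁, 1)` (a homomorphism from a product group). [cite: Liu2021, Lem. B.11 p. 102] -/
theorem iotaLeft_mul_iotaV (a Y₁ Y₂ : UnitaryGroup.adelic (Fp L) L (IsCMField.complexConj L) N (Matrix.diagonal dV)) :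
    iotaLeft L e dV hdV dW hdW a * iotaV L e dV hdV dW hdW (Y₁, Y₂) =
      iotaV L e dV hdV dW hdW (Y₂, Y₂) * iotaLeft L e dV hdV dW hdW (Y₂⁻¹ * a * Y₁) := by
  rw [iotaLeft_apply, iotaLeft_apply, ← map_mul, ← map_mul, Prod.mk_mul_mk, Prod.mk_mul_mk, mul_one, one_mul, ← mul_assoc, ← mul_assoc,
    mul_inv_cancel, one_mul]

/-- **The summand factorises**: for a Siegel section `f` of `I(s, χ)`,
`f(ι(ιA γ, 1) · ι(ιA k₁⁻¹, ιA k₂⁻¹)) = χ_s(ι(ιA k₂⁻¹, ιA k₂⁻¹)) · f(ι(ιA (k₂ γ k₁⁻¹), 1))` (`iotaLeft_mul_iotaV`, the section law on `ι(Y₂,Y₂) ∈ P_Δ(𝔸)`, ★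
`isSiegelDelta_iotaV_diag`). [cite: Liu2021, Lem. B.11 p. 102] -/
theorem apply_iotaLeft_mul_iotaV {χ : HeckeCharacter L} {s : ℂ} {f : HA L e dV hdV dW hdW → ℂ} (hf : IsSiegelDeltaSection L e dV hdV dW hdW χ s f)
    (γ k₁ k₂ : (adelicGroupData (↥(maximalRealSubfield L)) L (IsCMField.complexConj L) N H).Adelic) :
    f (iotaLeft L e dV hdV dW hdW (ιA γ) * iotaV L e dV hdV dW hdW (ιA k₁⁻¹, ιA k₂⁻¹)) =
      siegelDeltaCharacter L e dV hdV dW hdW χ s (iotaV L e dV hdV dW hdW (ιA k₂⁻¹, ιA k₂⁻¹)) *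
        f (iotaLeft L e dV hdV dW hdW (ιA (k₂ * γ * k₁⁻¹))) := by
  rw [iotaLeft_mul_iotaV, hf _ (isSiegelDelta_iotaV_diag L e dV hdV dW hdW _)]
  congr 3
  simp only [map_mul, map_inv, inv_inv]

/-! ## §4 The Eisenstein series along the orbit bijection -/

include ht hg hιA in
/-- **`E_F(h′) = Σ'_{γ ∈ G(L⁺)} F(ι(ιA γ, 1) · h′)`** for every `F : H(𝔸) → ℂ` blind to left rational Siegel factors (`F(p x) = F x`, `p ∈ P_Δ(L⁺)`),
under the single-orbit input: re-index ★ `eisensteinSeriesDelta`'s `tsum` over `P_Δ(L⁺)\H(L⁺)` along `σ` (`exists_orbitEquiv`, Mathlib `Equiv.tsum_eq`;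
no summability needed) and replace `Quotient.out (σ γ) = p · ι(ιA γ, 1)` using `F`'s blindness. [cite: Liu2021, Lem. B.11 p. 102] -/
theorem eisensteinSeriesDelta_eq_tsum
    (hMain : ∀ h : ratH L e dV hdV dW hdW, ∃ a₀ : UnitaryGroup.rational (Fp L) L (IsCMField.complexConj L) N (Matrix.diagonal dV),
      IsSiegelDelta L e dV hdV dW hdW ((h : HA L e dV hdV dW hdW) *
        (iotaLeft L e dV hdV dW hdW (UnitaryGroup.toAdelic (Fp L) L (IsCMField.complexConj L) N (Matrix.diagonal dV) a₀))⁻¹))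
    (F : HA L e dV hdV dW hdW → ℂ)
    (hF : ∀ (p : siegelDeltaRat L e dV hdV dW hdW) (x : HA L e dV hdV dW hdW), F (((p : ratH L e dV hdV dW hdW) : HA L e dV hdV dW hdW) * x) = F x)
    (h' : HA L e dV hdV dW hdW) :
    eisensteinSeriesDelta L e dV hdV dW hdW F h' =
      ∑' γ : (adelicGroupData (↥(maximalRealSubfield L)) L (IsCMField.complexConj L) N H).quotientSubgroup,
        F (iotaLeft L e dV hdV dW hdW (ιA γ) * h') := by
  obtain ⟨σ, hσ⟩ := exists_orbitEquiv L e H dV hdV dW hdW t ht g hg ιA hιA hMain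
  unfold eisensteinSeriesDelta
  rw [← Equiv.tsum_eq σ]
  refine tsum_congr fun γ => ?_
  -- `Quotient.out (σ γ) = p · ι(ιA γ, 1)` with `p ∈ P_Δ(L⁺)`
  have hrel : MulAction.orbitRel (siegelDeltaRat L e dV hdV dW hdW) (ratH L e dV hdV dW hdW) (Quotient.out (σ γ))
      ⟨iotaLeft L e dV hdV dW hdW (ιA γ), iotaLeft_iotaA_mem_ratH L e H dV hdV dW hdW t ht g hg ιA hιA γ.2⟩ :=
    Quotient.exact ((Quotient.out_eq (σ γ)).trans (hσ γ))
  obtain ⟨p, hp⟩ := MulAction.mem_orbit_iff.1 (MulAction.orbitRel_apply.1 hrel)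
  rw [Subgroup.smul_def, smul_eq_mul] at hp
  rw [← hp, Subgroup.coe_mul, mul_assoc, hF]

include ht hg hιA in
/-- **Summability transfers along the orbit bijection**: `Summable_q F(q.out · h′) ⟺ Summable_γ F(ι(ιA γ, 1) · h′)` for `F` blind to left rational
Siegel factors (Mathlib `Equiv.summable_iff` along `σ`). [cite: Liu2021, Lem. B.11 p. 102] -/
theorem summable_eisenstein_iff
    (hMain : ∀ h : ratH L e dV hdV dW hdW, ∃ a₀ : UnitaryGroup.rational (Fp L) L (IsCMField.complexConj L) N (Matrix.diagonal dV),
      IsSiegelDelta L e dV hdV dW hdW ((h : HA L e dV hdV dW hdW) *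
        (iotaLeft L e dV hdV dW hdW (UnitaryGroup.toAdelic (Fp L) L (IsCMField.complexConj L) N (Matrix.diagonal dV) a₀))⁻¹))
    {E' : Type*} [AddCommMonoid E'] [TopologicalSpace E'] (F : HA L e dV hdV dW hdW → E')
    (hF : ∀ (p : siegelDeltaRat L e dV hdV dW hdW) (x : HA L e dV hdV dW hdW), F (((p : ratH L e dV hdV dW hdW) : HA L e dV hdV dW hdW) * x) = F x)
    (h' : HA L e dV hdV dW hdW) :
    (Summable fun q : SiegelDeltaQuot L e dV hdV dW hdW => F (((Quotient.out q : ratH L e dV hdV dW hdW) : HA L e dV hdV dW hdW) * h')) ↔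
      Summable fun γ : (adelicGroupData (↥(maximalRealSubfield L)) L (IsCMField.complexConj L) N H).quotientSubgroup =>
        F (iotaLeft L e dV hdV dW hdW (ιA γ) * h') := by
  obtain ⟨σ, hσ⟩ := exists_orbitEquiv L e H dV hdV dW hdW t ht g hg ιA hιA hMain
  rw [← Equiv.summable_iff σ]
  have heq : (fun q : SiegelDeltaQuot L e dV hdV dW hdW => F (((Quotient.out q : ratH L e dV hdV dW hdW) : HA L e dV hdV dW hdW) * h')) ∘ σ =
      fun γ : (adelicGroupData (↥(maximalRealSubfield L)) L (IsCMField.complexConj L) N H).quotientSubgroup =>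
        F (iotaLeft L e dV hdV dW hdW (ιA (γ : (adelicGroupData (↥(maximalRealSubfield L)) L (IsCMField.complexConj L) N H).Adelic)) * h') := by
    funext γ
    simp only [Function.comp_apply]
    have hrel : MulAction.orbitRel (siegelDeltaRat L e dV hdV dW hdW) (ratH L e dV hdV dW hdW) (Quotient.out (σ γ))
        ⟨iotaLeft L e dV hdV dW hdW (ιA γ), iotaLeft_iotaA_mem_ratH L e H dV hdV dW hdW t ht g hg ιA hιA γ.2⟩ :=
      Quotient.exact ((Quotient.out_eq (σ γ)).trans (hσ γ))
    obtain ⟨p, hp⟩ := MulAction.mem_orbit_iff.1 (MulAction.orbitRel_apply.1 hrel)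
    rw [Subgroup.smul_def, smul_eq_mul] at hp
    rw [← hp, Subgroup.coe_mul, mul_assoc, hF]
  rw [heq]

/-- A Siegel section is blind to left rational Siegel factors in NORM as well: `‖f(p x)‖ = ‖f x‖` (★ `apply_siegelDeltaRat_mul`); the real- and
complex-valued norm functions needed for `E_{‖f‖}`. [cite: Liu2021, Lem. B.10 (2) p. 102] -/
theorem norm_apply_siegelDeltaRat_mul {χ : HeckeCharacter L} {s : ℂ} {f : HA L e dV hdV dW hdW → ℂ}
    (hf : IsSiegelDeltaSection L e dV hdV dW hdW χ s f) (p : siegelDeltaRat L e dV hdV dW hdW) (x : HA L e dV hdV dW hdW) :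
    ‖f ((((p : ratH L e dV hdV dW hdW) : HA L e dV hdV dW hdW)) * x)‖ = ‖f x‖ ∧
      (((‖f ((((p : ratH L e dV hdV dW hdW) : HA L e dV hdV dW hdW)) * x)‖ : ℝ) : ℂ) = ((‖f x‖ : ℝ) : ℂ)) := by
  rw [apply_siegelDeltaRat_mul L e dV hdV dW hdW hf p x]
  exact ⟨rfl, rfl⟩

end Summit.HodgeConjecture.HodgeConjecture.Cruxes.HLiu418.K2LiuDoublingUnfoldOrbit
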